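import Summits.QuantumFields.YangMills.Theorems.BalabanUVNodesN16HolderShapeOfLeaf
import Summits.QuantumFields.YangMills.Theorems.BalabanUVNodesN16HolderMSLeafSlot
import HarnessLib

/-!
# Route «BalabanUVNodes» (K3⁗ `SpineGivenEndpointR13Sep`), DAG node N16 = NE3 — THE HÖLDER ROOT, THE ROW's DECL `NE3Shape` AND THE LEAF SLOTS FROM NODE N05's
# THEOREM 4 ∕ PROPOSITION 3 AS TYPED on `zdGF3 (M_n ℂ) L β len` over the univ sub-index (re-cut of the «leaf of record SHAPE» ★s of generation 3 and of
# n16-e's slot faces, after n05-c's certificate p501857 that the SHAPE `B8LeafKnitRS.B8LeafRS` is uninhabited there; companion of file 40 `N16OfLeafTP`)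

Cell `pub-ymgap`, seat `pub-ymgap-dag-n16-c` (R134 fan-out seat, strategy s1; HUMAN RULING D-0062; chair R424 venue), generation 5, file 41 — over generation 3's
files 14 ∕ 16 ∕ 19 (`N16HolderOfLeaf.n16_holder_of_leaf`, `N16HolderLeafSlot.LeafSlotHolder`, `N16HolderShapeOfLeaf.ne3Shape_of_leaf_holder`) and n16-e's
`N16LeafSlot.LeafSlot` ∕ `N16HolderMSLeafSlot.LeafSlotHolderMS`.  `--supports stmt-QuantumFields-20292 --as helper` (K3⁗, dag-lead WORDS-140).
`bears_on: R4∕N16 · edge N05 → N16`.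

WHY.  n05-c's `B8LeafModelZd3SourceReality.not_thm8SurvivingAt_zdGF3_univ` (p501857) makes the hypothesis `B8LeafRS 4 L … (fun i : {i : ZdIdx 4 L // i.Ω 0 = univ} ↦
zdGF3 (M_n ℂ) L β len i.1) lan cub toAxial` UNINHABITED for `L ≥ 2` (its conjunct `t8`; certificate restated at the N16 face in file 40 §1).  Hence generation 3's
`n16_holder_of_b8LeafRS`, `leafSlotHolder_of_b8LeafRS`, `ne3Shape_of_b8LeafRS_holder` and n16-e's `N16LeafSlotRS.leafSlot_of_b8LeafRS` ∕
`N16HolderMSLeafSlot.leafSlotHolderMS_of_b8LeafRS` — which read only the fields `t4`, `p3` of that hypothesis — are VACUOUS as stated.  THIS FILE re-cuts each at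
the two fields actually read, [Balaban1985RegularSpaces] Theorem 4 (p. 88) and Proposition 3 (p. 87) AS TYPED: `B8.Thm4Printed B₁′ fam` (= `∃ c₁ > 0, Thm4Body c₁ B₁′
fam`) and `B8.Prop3Printed 4 L C₂ inp B₀β fam₂` (= `∃ cP > 0, Prop3Body …`) at `fam := fun i : {i // i.Ω 0 = univ} ↦ zdGF3 (M_n ℂ) L β len i.1`, conclusions VERBATIM
(window threshold `c₁′` by generation 0's `exists_window_print`).  Neither printed sentence reads the source space `Src` whose typing p501857 exploits.

WHAT THIS FILE PROVES (kernel, theorems only, 0 `def`, 0 sorry): `n16_holder_of_leafTP` (R-β root `CovRootHolder …  β dom`, any `β ∈ [0,1]`), `ne3Shape_of_leafTP_holder`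
(the YM-PLAN row decl `T4EtaRateMin.NE3Shape` at the minimal-action readings, any `β ∈ [0,1]`), `leafSlotHolder_of_leafTP` (`LeafSlotHolder c β`), `leafSlot_of_leafTP`
(β = 1: n16-e's `LeafSlot c`), `leafSlotHolderMS_of_leafTP` (n16-e's `LeafSlotHolderMS c β`, multi-scale letters).
HONEST FRAMING: bookkeeping by name; nothing of Bałaban is proved here; Theorem 4 ∕ Proposition 3 on `zdGF3` at curved backgrounds are node N05's theorems (in the tree
only modulo n05-a's sockets `SockP5base ∕ SockP5 ∕ SockH59 ∕ SockP5u ∕ SockB9P3`), (H3ˢᵘᵖ) = N07's [Balaban1985Variational] Thm 1 TYPE; N16 ∕ NE3 NOT discharged;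
count-neutral; one finite four-torus at fixed ε — NOT ℝ⁴, NOT infinite volume, NOT OS, NOT a mass gap, NOT Clay.
-/

set_option autoImplicit false

open scoped BigOperators Matrix Matrix.Norms.L2Operator
open NormedSpace

namespace Summit.QuantumFields.YangMills.BalabanUVNodes.N16OfLeafTPHolder

open Literature.MathematicalPhysics.QuantumFieldTheory.Balaban1983to89
open B7Prop1Explicit B7Prop2Explicit
open B7Prop3Flat (c3)
open T4AveragingDeficitWall (fineAction blockSites)
open T4AveragingDeficitWallBoundary (periodBox)
open T4EtaRateMin (NE3Shape)
open B8LeafModelZd (ZdIdx)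
open B8LeafModelZd3 (zdGF3)
open Summit.QuantumFields.BalabanUV.T4Continuum
open MinimalActionSandwich (IsMinimiser)
open MinimalActionRate (sfClass minActReadings)
open MinimalActionRefine (RegularSup)
open BlockAverageCurrent (curConst)
open NE3RightInverseSupLetters (frameC)
open NE3.LeafIndexSockets (LeafH3sup)
open YMDAG.UVSplit (NE3Carriers)
open Summit.QuantumFields.YangMills.BalabanUVNodes.N16HolderDefs (CovRootHolder)
open Summit.QuantumFields.YangMills.BalabanUVNodes.N16HolderOfLeaf (n16_holder_of_leaf)
open Summit.QuantumFields.YangMills.BalabanUVNodes.N16HolderShapeOfLeaf (ne3Shape_of_leaf_holder)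
open Summit.QuantumFields.YangMills.BalabanUVNodes.N16HolderLeafSlot (LeafSlotHolder leafSlotHolder_one_iff)
open Summit.QuantumFields.YangMills.BalabanUVNodes.N16HolderMSLeafSlot (LeafSlotHolderMS)
open Summit.QuantumFields.YangMills.BalabanUVNodes.N16LeafSlot (LeafSlot)
open Summit.QuantumFields.YangMills.BalabanUVNodes.N16.OfLeaf (exists_window_print)

noncomputable section

/-! ## §1 The R-β root and the row's decl from Theorem 4 ∕ Proposition 3 on `zdGF3 (M_n ℂ) L β len`, any `β ∈ [0,1]` -/

section Matrices

variable {n : Type} [Fintype n] [DecidableEq n]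

/-- **N16 · THE β-ROOT FROM NODE N05's THEOREM 4 AND PROPOSITION 3 ON `zdGF3 (M_n(ℂ)) L β len` OVER THE UNIV SUB-INDEX, AND N07's (H3ˢᵘᵖ)** (`d = 4`, `L ≥ 2`, `N ≥ 1`,
ANY `β ∈ [0, 1]`; repair R-β) — generation 3's `N16HolderOfLeaf.n16_holder_of_b8LeafRS` with its ONE (uninhabited, file 40 §1) hypothesis `B8LeafRS …` REPLACED by the two
fields it read: `B8.Thm4Printed B₁′ fam` ([Balaban1985RegularSpaces] Thm 4 p. 88 as typed) and `B8.Prop3Printed 4 L C₂ inp B₀β fam₂` (Prop 3 p. 87) at `fam := fun i :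
{i : ZdIdx 4 L // i.Ω 0 = univ} ↦ zdGF3 (M_n ℂ) L β len i.1`; letters `len ≥ 1` on its support, `len e_μ = 1`, `0 < B₁′`, `5·4·L·B₀ ≤ B₁′`.  Conclusion VERBATIM: `∃ c₁′ >
0` with `16·(5·4·L·B₀)·c₁′ ≤ 1` and file 14 §2's tail, ending in `LeafH3sup 4 L N ε b′ c′ dom → CovRootHolder 4 (sfClass 4 L N ε) L N b g C s₁ s₂ β dom`.  N16 ∕ NE3 NOT
proved: Theorem 4 ∕ Proposition 3 on the `ℤ⁴` carriers are node N05's theorems, (H3ˢᵘᵖ) is N07's. [cite: Balaban1985RegularSpaces, Thm 4 p.88, Prop. 3 p.87, (1.36) p.82] [folklore] -/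
theorem n16_holder_of_leafTP [Nonempty n] {L N : ℕ} (hL : 2 ≤ L) (hN : 1 ≤ N) :
    letI : CStarAlgebra (Matrix n n ℂ) := {}
    ∃ r : ℝ, 0 < r ∧ ∀ ⦃g : ℝ⦄, 0 < g → ∃ C : ℝ, 0 ≤ C ∧
      ∀ ⦃β : ℝ⦄, 0 ≤ β → β ≤ 1 → ∀ (C₂ B₁' : ℝ) (inp : B8.B9Inputs) (B₀β : ℝ) (len : Site 4 → ℝ),
      (∀ v : Site 4, 0 < len v → 1 ≤ len v) → (∀ μ : Fin 4, len (e μ) = 1) → 0 < B₁' → 5 * ((4 : ℕ) : ℝ) * L * inp.B₀ ≤ B₁' →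
      B8.Thm4Printed B₁' (fun i : {i : ZdIdx 4 L // i.Ω 0 = Set.univ} => (zdGF3 (Matrix n n ℂ) L β len i.1).toGFData) →
      B8.Prop3Printed 4 (L : ℝ) C₂ inp B₀β
        (fun i : {i : ZdIdx 4 L // i.Ω 0 = Set.univ} => (zdGF3 (Matrix n n ℂ) L β len i.1).toGFData2) →
      ∃ c₁' : ℝ, 0 < c₁' ∧ 16 * (5 * ((4 : ℕ) : ℝ) * L * inp.B₀ * c₁') ≤ 1 ∧
      ∀ ⦃b' c' : ℝ⦄, 0 ≤ b' → 0 ≤ c' →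
      2 ^ 15 * ((4 : ℝ) + 1) ^ 2 * ((4 : ℝ) + 4) ^ 2 * (L : ℝ) ^ 2 * b' ≤ 1 →
      23040 * (4 : ℝ) ^ 4 * (frameC 4 L + 4) ^ 3 * (c' + curConst 4 L * b' ^ 2) ≤ 1 →
      ∀ ⦃α : ℝ⦄, 0 < α → C0 4 * α ≤ 1 / 3 → 2 * α ≤ c2' 4 L → 11 * (4 : ℝ) ^ 2 * α ≤ 1 / 6 → α + 11 * (4 : ℝ) ^ 2 * α ≤ c₁' →
      b' + 226 * (8 * ((4 : ℝ) + 1) * ((4 : ℝ) + 4)) ^ 2 * b' ^ 2 < α → 4 * ((4 : ℝ) - 1) * (c' + curConst 4 L * b' ^ 2) < α →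
      ∀ ⦃Mc : ℝ⦄, 0 ≤ Mc → (Mc + 1) * (b' + 226 * (8 * ((4 : ℝ) + 1) * ((4 : ℝ) + 4)) ^ 2 * b' ^ 2) ≤ 1 / 2 →
      ∀ (𝒬 : ℕ → Set (Set (Site 4) × ℕ)), (∀ k, ∀ q ∈ 𝒬 k, q.2 ≤ k ∧ ∃ y : Site 4, ∀ z ∈ q.1, (l1 (z - y) : ℝ) ≤ Mc * (L : ℝ) ^ q.2) →
      ∀ ⦃C335 : ℝ⦄, 2 * (Mc + 1) * (b' + 226 * (8 * ((4 : ℝ) + 1) * ((4 : ℝ) + 4)) ^ 2 * b' ^ 2) + 2 * Mc * (2 * (c' + curConst 4 L * b' ^ 2)) +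
        4 * Mc * (1 + 2 * Mc) * (b' + 226 * (8 * ((4 : ℝ) + 1) * ((4 : ℝ) + 4)) ^ 2 * b' ^ 2) ^ 2 < C335 →
      ∀ ⦃ε s₁ b s₂ : ℝ⦄, 0 < ε → ε ≤ r → ε < α → 0 ≤ s₁ → s₁ ≤ r → 0 ≤ b → b ≤ ε / 2 →
      5 * ((4 : ℕ) : ℝ) * L * inp.B₀ * (α + 11 * (4 : ℝ) ^ 2 * α) ≤ s₁ →
      5 * ((4 : ℕ) : ℝ) * L * inp.B₀ * (α + 11 * (4 : ℝ) ^ 2 * α) +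
          2 * (b' + 226 * (8 * ((4 : ℝ) + 1) * ((4 : ℝ) + 4)) ^ 2 * b' ^ 2) * s₁ ≤ s₁ →
      5 * ((4 : ℕ) : ℝ) * L * inp.B₀ * (α + 11 * (4 : ℝ) ^ 2 * α) + 16 * (b' + 226 * (8 * ((4 : ℝ) + 1) * ((4 : ℝ) + 4)) ^ 2 * b' ^ 2) *
          (5 * ((4 : ℕ) : ℝ) * L * inp.B₀ * (α + 11 * (4 : ℝ) ^ 2 * α)) ≤ s₁ →
      5 * ((4 : ℕ) : ℝ) * L * B₀β * (α + 11 * (4 : ℝ) ^ 2 * α) + 8 * (b' + 226 * (8 * ((4 : ℝ) + 1) * ((4 : ℝ) + 4)) ^ 2 * b' ^ 2) *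
          (5 * ((4 : ℕ) : ℝ) * L * inp.B₀ * (α + 11 * (4 : ℝ) ^ 2 * α)) ≤ s₂ →
      ∀ {dom : _root_.Set (Site 4 → Fin 4 → (Matrix n n ℂ)ˣ)},
        LeafH3sup 4 L N ε b' c' dom →
        CovRootHolder 4 (sfClass 4 L N ε) L N b g C s₁ s₂ β dom := by
  letI : CStarAlgebra (Matrix n n ℂ) := {}
  obtain ⟨r, hr0, hr⟩ := n16_holder_of_leaf (n := n) hL hN
  refine ⟨r, hr0, fun g hg => ?_⟩
  obtain ⟨C, hC0, hC⟩ := hr hg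
  refine ⟨C, hC0, fun β hβ0 hβ1 C₂ B₁' inp B₀β len hlen hlen1 hB₁' hBB hT4 hP3 => ?_⟩
  -- the two printed thresholds, and the window threshold below them
  obtain ⟨c₁t, hc₁t, hT⟩ := hT4
  obtain ⟨cP, hcP, hP⟩ := hP3
  obtain ⟨c₁', hc₁', hwin⟩ := exists_window_print (d := 4) (L := L) (by norm_num) hL C₂ hc₁t hcP hB₁'
  have h16 : 16 * (5 * ((4 : ℕ) : ℝ) * L * inp.B₀ * c₁') ≤ 1 := by
    obtain ⟨-, -, -, h, -⟩ := hwin (c₁' / 2) (c₁' / 2) (by linarith) (by linarith) (by linarith)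
    have h' : 16 * (B₁' * c₁') ≤ 1 := by rwa [add_halves] at h
    nlinarith [mul_le_mul_of_nonneg_right hBB hc₁'.le]
  refine ⟨c₁', hc₁', h16, fun b' c' hb' hc' hRb hcF α hα hA3 hA2 hAs hAc hb'α hc'α Mc hMc hMcα 𝒬 h𝒬 C335 hC335 ε s₁ b s₂ hε hεr hεα hs₁
    hs₁r hb hbh hss hgrad hℓ hhol dom h3 => ?_⟩
  exact hC c₁t c₁' B₁' cP C₂ B₀β inp len hlen hlen1 hB₁' hBB h16 hwin hb' hc' hRb hcF hα hA3 hA2 hAs hAc hb'α hc'α hMc hMcα 𝒬 h𝒬 hC335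
    hε hεr hεα hs₁ hs₁r hb hbh hss hgrad hℓ hhol hβ0 hβ1 hT hP h3

/-- **N16 · THE ROW's DECL `NE3Shape` FROM NODE N05's THEOREM 4 AND PROPOSITION 3 ON `zdGF3 (M_n(ℂ)) L β len` OVER THE UNIV SUB-INDEX AND N07's (H3ˢᵘᵖ)** (`d = 4`,
`L ≥ 2`, `N ≥ 1`, ANY `β ∈ [0, 1]`) — generation 3's `N16HolderShapeOfLeaf.ne3Shape_of_b8LeafRS_holder` with its ONE (uninhabited) hypothesis `B8LeafRS …` REPLACED by
`B8.Thm4Printed B₁′ fam` and `B8.Prop3Printed 4 L C₂ inp B₀β fam₂` at `fam := fun i : {i // i.Ω 0 = univ} ↦ zdGF3 (M_n ℂ) L β len i.1`; letters `len ≥ 1` on its support,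
`len e_μ = 1`, `0 < B₁′`, `5·4·L·B₀ ≤ B₁′`.  Conclusion VERBATIM: `∃ c₁′ > 0` with `16·(5·4·L·B₀)·c₁′ ≤ 1` and file 19 §1's tail (the shape regime, the averaging letter,
the (3.35) schedule, the four letter lines), ending in `dom ⊆ sfClass 4 L N ε₁ 0 → LeafH3sup 4 L N ε b c dom → (a regular minimising selection exists) ∧ ∀ sel, ∃ C′ ≥ 0,
NE3Shape (minActReadings …) C′ (L⁻¹)`.  N16 ∕ NE3 NOT proved: Theorem 4 ∕ Proposition 3 on the `ℤ⁴` carriers are node N05's theorems, (H3ˢᵘᵖ) is N07's.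
[cite: Balaban1985RegularSpaces, Thm 4 p.88, Prop. 3 p.87] [folklore] -/
theorem ne3Shape_of_leafTP_holder [Nonempty n] {L N : ℕ} (hL : 2 ≤ L) (hN : 1 ≤ N) :
    letI : CStarAlgebra (Matrix n n ℂ) := {}
    ∃ r : ℝ, 0 < r ∧
      ∀ ⦃β : ℝ⦄, 0 ≤ β → β ≤ 1 → ∀ (C₂ B₁' : ℝ) (inp : B8.B9Inputs) (B₀β : ℝ) (len : Site 4 → ℝ),
      (∀ v : Site 4, 0 < len v → 1 ≤ len v) → (∀ μ : Fin 4, len (e μ) = 1) → 0 < B₁' → 5 * ((4 : ℕ) : ℝ) * L * inp.B₀ ≤ B₁' →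
      B8.Thm4Printed B₁' (fun i : {i : ZdIdx 4 L // i.Ω 0 = Set.univ} => (zdGF3 (Matrix n n ℂ) L β len i.1).toGFData) →
      B8.Prop3Printed 4 (L : ℝ) C₂ inp B₀β
        (fun i : {i : ZdIdx 4 L // i.Ω 0 = Set.univ} => (zdGF3 (Matrix n n ℂ) L β len i.1).toGFData2) →
      ∃ c₁' : ℝ, 0 < c₁' ∧ 16 * (5 * ((4 : ℕ) : ℝ) * L * inp.B₀ * c₁') ≤ 1 ∧
      ∀ ⦃ε s₁ t b c ε₁ : ℝ⦄, 0 < ε → ε ≤ r → 0 ≤ s₁ → s₁ ≤ r →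
      0 ≤ b → b ≤ t → 0 < c → c ≤ t →
      (2 : ℝ) ^ 91 * (L : ℝ) ^ 17 * t ≤ 1 → (2 : ℝ) ^ 76 * (L : ℝ) ^ 12 * t ≤ ε →
      16 * C0 4 * ε ≤ 3 → 1024 * (4 + 1) * (4 + 4) * (L : ℝ) ^ 2 * ε ≤ 1 → b ≤ ε / 2 →
      23040 * (4 : ℝ) ^ 4 * (frameC 4 L + 4) ^ 3 * (c + curConst 4 L * b ^ 2) ≤ 1 →
      ε₁ ≤ 1 / 4 → ε₁ ≤ b → 4 * ε₁ ≤ c →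
      ∀ ⦃α : ℝ⦄, 0 < α → ε < α → C0 4 * α ≤ 1 / 3 → 2 * α ≤ c2' 4 L → 11 * (4 : ℝ) ^ 2 * α ≤ 1 / 6 → α + 11 * (4 : ℝ) ^ 2 * α ≤ c₁' →
      b + 226 * (8 * ((4 : ℝ) + 1) * ((4 : ℝ) + 4)) ^ 2 * b ^ 2 < α → 4 * ((4 : ℝ) - 1) * (c + curConst 4 L * b ^ 2) < α →
      ∀ ⦃Mc : ℝ⦄, 0 ≤ Mc → (Mc + 1) * (b + 226 * (8 * ((4 : ℝ) + 1) * ((4 : ℝ) + 4)) ^ 2 * b ^ 2) ≤ 1 / 2 →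
      ∀ (𝒬 : ℕ → Set (Set (Site 4) × ℕ)), (∀ k, ∀ q ∈ 𝒬 k, q.2 ≤ k ∧ ∃ y : Site 4, ∀ z ∈ q.1, (l1 (z - y) : ℝ) ≤ Mc * (L : ℝ) ^ q.2) →
      ∀ ⦃C335 : ℝ⦄, 2 * (Mc + 1) * (b + 226 * (8 * ((4 : ℝ) + 1) * ((4 : ℝ) + 4)) ^ 2 * b ^ 2) + 2 * Mc * (2 * (c + curConst 4 L * b ^ 2)) +
        4 * Mc * (1 + 2 * Mc) * (b + 226 * (8 * ((4 : ℝ) + 1) * ((4 : ℝ) + 4)) ^ 2 * b ^ 2) ^ 2 < C335 →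
      ∀ ⦃s₂ : ℝ⦄,
      5 * ((4 : ℕ) : ℝ) * L * inp.B₀ * (α + 11 * (4 : ℝ) ^ 2 * α) ≤ s₁ →
      5 * ((4 : ℕ) : ℝ) * L * inp.B₀ * (α + 11 * (4 : ℝ) ^ 2 * α) +
          2 * (b + 226 * (8 * ((4 : ℝ) + 1) * ((4 : ℝ) + 4)) ^ 2 * b ^ 2) * s₁ ≤ s₁ →
      5 * ((4 : ℕ) : ℝ) * L * inp.B₀ * (α + 11 * (4 : ℝ) ^ 2 * α) + 16 * (b + 226 * (8 * ((4 : ℝ) + 1) * ((4 : ℝ) + 4)) ^ 2 * b ^ 2) *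
          (5 * ((4 : ℕ) : ℝ) * L * inp.B₀ * (α + 11 * (4 : ℝ) ^ 2 * α)) ≤ s₁ →
      5 * ((4 : ℕ) : ℝ) * L * B₀β * (α + 11 * (4 : ℝ) ^ 2 * α) + 8 * (b + 226 * (8 * ((4 : ℝ) + 1) * ((4 : ℝ) + 4)) ^ 2 * b ^ 2) *
          (5 * ((4 : ℕ) : ℝ) * L * inp.B₀ * (α + 11 * (4 : ℝ) ^ 2 * α)) ≤ s₂ →
      ∀ {dom : _root_.Set (Site 4 → Fin 4 → (Matrix n n ℂ)ˣ)}, dom ⊆ sfClass 4 L N ε₁ 0 →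
        LeafH3sup 4 L N ε b c dom →
        (∃ sel : ℕ → (Site 4 → Fin 4 → (Matrix n n ℂ)ˣ) → (Site 4 → Fin 4 → (Matrix n n ℂ)ˣ),
            ∀ V ∈ dom, ∀ k : ℕ, IsMinimiser 4 (sfClass 4 L N ε) L N k V (sel k V) ∧ RegularSup 4 L N b c k (sel k V)) ∧
        ∀ sel : ℕ → (Site 4 → Fin 4 → (Matrix n n ℂ)ˣ) → (Site 4 → Fin 4 → (Matrix n n ℂ)ˣ),
          (∀ V ∈ dom, ∀ k : ℕ, IsMinimiser 4 (sfClass 4 L N ε) L N k V (sel k V)) →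
          (∀ V ∈ dom, ∀ k : ℕ, RegularSup 4 L N b c k (sel k V)) →
          ∃ C' : ℝ, 0 ≤ C' ∧
            NE3Shape
              (minActReadings 4 (sfClass 4 L N ε) L N dom
                (fun k V (x : ↥(periodBox (d := 4) N)) =>
                  fineAction (sel k V) (((blockSites L)^[k] {(x : Site 4)}) ×ˢ Finset.univ)))
              C' ((L : ℝ)⁻¹) := by
  letI : CStarAlgebra (Matrix n n ℂ) := {}
  obtain ⟨r, hr0, hr⟩ := ne3Shape_of_leaf_holder (n := n) hL hN
  refine ⟨r, hr0, fun β hβ0 hβ1 C₂ B₁' inp B₀β len hlen hlen1 hB₁' hBB hT4 hP3 => ?_⟩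
  -- the two printed thresholds, and the window threshold below them
  obtain ⟨c₁t, hc₁t, hT⟩ := hT4
  obtain ⟨cP, hcP, hP⟩ := hP3
  obtain ⟨c₁', hc₁', hwin⟩ := exists_window_print (d := 4) (L := L) (by norm_num) hL C₂ hc₁t hcP hB₁'
  have h16 : 16 * (5 * ((4 : ℕ) : ℝ) * L * inp.B₀ * c₁') ≤ 1 := by
    obtain ⟨-, -, -, h, -⟩ := hwin (c₁' / 2) (c₁' / 2) (by linarith) (by linarith) (by linarith)
    have h' : 16 * (B₁' * c₁') ≤ 1 := by rwa [add_halves] at h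
    nlinarith [mul_le_mul_of_nonneg_right hBB hc₁'.le]
  refine ⟨c₁', hc₁', h16, fun ε s₁ t b c ε₁ hε hεr hs₁ hs₁r hb hbt hc hct hsmall hεt hε1 hε2 hbε hcF hε₁ hε₁b hε₁c α hα hεα hA3 hA2 hAs hAc hbα hcα
    Mc hMc hMcα 𝒬 h𝒬 C335 hC335 s₂ hss hgrad hℓ hhol dom hdom h3 => ?_⟩
  exact hr c₁t c₁' B₁' cP C₂ B₀β inp len hlen hlen1 hB₁' hBB h16 hwin hε hεr hs₁ hs₁r hb hbt hc hct hsmall hεt hε1 hε2 hbε hcF hε₁ hε₁b hε₁c hα hεα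
    hA3 hA2 hAs hAc hbα hcα hMc hMcα 𝒬 h𝒬 hC335 hss hgrad hℓ hhol hβ0 hβ1 hT hP hdom h3

end Matrices

/-! ## §2 The leaf slots at a bundle `c : NE3Carriers N` from Theorem 4 ∕ Proposition 3 on `zdGF3 (M_N ℂ) c.L β len` -/

section Slots

variable {N : ℕ}

/-- **FROM NODE N05's THEOREM 4 AND PROPOSITION 3 AT ITS RESIDUAL EXPONENT TO THE LEAF β-SLOT** (`2 ≤ c.L`; any `β`) — generation 3's
`N16HolderLeafSlot.leafSlotHolder_of_b8LeafRS` with its uninhabited hypothesis `B8LeafRS …` REPLACED by `B8.Thm4Printed B₁′ fam` and `B8.Prop3Printed 4 c.L C₂ inp B₀β fam₂`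
at `fam := fun i : {i : ZdIdx 4 c.L // i.Ω 0 = univ} ↦ zdGF3 (M_N ℂ) c.L β len i.1`; `len ≥ 1` on its support, `len e_μ = 1`, `0 < B₁′`, `5·4·c.L·B₀ ≤ B₁′` YIELD a window
threshold `c₁′ > 0` with `16·(5·4·c.L·B₀·c₁′) ≤ 1` (`exists_window_print`) such that, for all leaf letters, averaging letter, (3.35) schedule on the slot's displayed lines at
`c₁′` with `B := 5·4·c.L·B₀`, `B_h := 5·4·c.L·B₀β`, N07's `LeafH3sup` gives `LeafSlotHolder c β`. [cite: Balaban1985RegularSpaces, Thm 4 p.88, Prop. 3 p.87] [folklore] -/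
theorem leafSlotHolder_of_leafTP [NeZero N] (c : NE3Carriers N) (hL : 2 ≤ c.L) {β : ℝ} {C₂ B₁' : ℝ} {inp : B8.B9Inputs} {B₀β : ℝ}
    {len : Site 4 → ℝ} (hlen : ∀ v : Site 4, 0 < len v → 1 ≤ len v) (hlen1 : ∀ μ : Fin 4, len (e μ) = 1) (hB₁' : 0 < B₁')
    (hBB : 5 * ((4 : ℕ) : ℝ) * c.L * inp.B₀ ≤ B₁')
    (hT4 : letI : CStarAlgebra (Matrix (Fin N) (Fin N) ℂ) := {}
      B8.Thm4Printed B₁' (fun i : {i : ZdIdx 4 c.L // i.Ω 0 = Set.univ} => (zdGF3 (Matrix (Fin N) (Fin N) ℂ) c.L β len i.1).toGFData))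
    (hP3 : letI : CStarAlgebra (Matrix (Fin N) (Fin N) ℂ) := {}
      B8.Prop3Printed 4 (c.L : ℝ) C₂ inp B₀β
        (fun i : {i : ZdIdx 4 c.L // i.Ω 0 = Set.univ} => (zdGF3 (Matrix (Fin N) (Fin N) ℂ) c.L β len i.1).toGFData2)) :
    ∃ c₁' : ℝ, 0 < c₁' ∧ 16 * (5 * ((4 : ℕ) : ℝ) * c.L * inp.B₀ * c₁') ≤ 1 ∧
      ∀ ⦃b' c' : ℝ⦄, 0 ≤ b' → 0 ≤ c' →
      2 ^ 15 * ((4 : ℝ) + 1) ^ 2 * ((4 : ℝ) + 4) ^ 2 * (c.L : ℝ) ^ 2 * b' ≤ 1 →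
      23040 * (4 : ℝ) ^ 4 * (frameC 4 c.L + 4) ^ 3 * (c' + curConst 4 c.L * b' ^ 2) ≤ 1 →
      ∀ ⦃α : ℝ⦄, 0 < α → C0 4 * α ≤ 1 / 3 → 2 * α ≤ c2' 4 c.L → 11 * (4 : ℝ) ^ 2 * α ≤ 1 / 6 → α + 11 * (4 : ℝ) ^ 2 * α ≤ c₁' →
      b' + 226 * (8 * ((4 : ℝ) + 1) * ((4 : ℝ) + 4)) ^ 2 * b' ^ 2 < α → 4 * ((4 : ℝ) - 1) * (c' + curConst 4 c.L * b' ^ 2) < α →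
      ∀ ⦃Mc : ℝ⦄, 0 ≤ Mc → (Mc + 1) * (b' + 226 * (8 * ((4 : ℝ) + 1) * ((4 : ℝ) + 4)) ^ 2 * b' ^ 2) ≤ 1 / 2 →
      ∀ (𝒬 : ℕ → Set (Set (Site 4) × ℕ)), (∀ k, ∀ q ∈ 𝒬 k, q.2 ≤ k ∧ ∃ y : Site 4, ∀ z ∈ q.1, (l1 (z - y) : ℝ) ≤ Mc * (c.L : ℝ) ^ q.2) →
      ∀ ⦃C335 : ℝ⦄, 2 * (Mc + 1) * (b' + 226 * (8 * ((4 : ℝ) + 1) * ((4 : ℝ) + 4)) ^ 2 * b' ^ 2) + 2 * Mc * (2 * (c' + curConst 4 c.L * b' ^ 2)) +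
        4 * Mc * (1 + 2 * Mc) * (b' + 226 * (8 * ((4 : ℝ) + 1) * ((4 : ℝ) + 4)) ^ 2 * b' ^ 2) ^ 2 < C335 →
      c.ε < α → 5 * ((4 : ℕ) : ℝ) * c.L * inp.B₀ * (α + 11 * (4 : ℝ) ^ 2 * α) ≤ c.Λ₁ →
      5 * ((4 : ℕ) : ℝ) * c.L * inp.B₀ * (α + 11 * (4 : ℝ) ^ 2 * α) +
          2 * (b' + 226 * (8 * ((4 : ℝ) + 1) * ((4 : ℝ) + 4)) ^ 2 * b' ^ 2) * c.Λ₁ ≤ c.Λ₁ →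
      5 * ((4 : ℕ) : ℝ) * c.L * inp.B₀ * (α + 11 * (4 : ℝ) ^ 2 * α) + 16 * (b' + 226 * (8 * ((4 : ℝ) + 1) * ((4 : ℝ) + 4)) ^ 2 * b' ^ 2) *
          (5 * ((4 : ℕ) : ℝ) * c.L * inp.B₀ * (α + 11 * (4 : ℝ) ^ 2 * α)) ≤ c.Λ₁ →
      5 * ((4 : ℕ) : ℝ) * c.L * B₀β * (α + 11 * (4 : ℝ) ^ 2 * α) + 8 * (b' + 226 * (8 * ((4 : ℝ) + 1) * ((4 : ℝ) + 4)) ^ 2 * b' ^ 2) *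
          (5 * ((4 : ℕ) : ℝ) * c.L * inp.B₀ * (α + 11 * (4 : ℝ) ^ 2 * α)) ≤ c.Λ₂' →
      LeafH3sup 4 c.L c.Nper c.ε b' c' c.dom → LeafSlotHolder c β := by
  letI : CStarAlgebra (Matrix (Fin N) (Fin N) ℂ) := {}
  -- the two printed thresholds, and the window threshold below them
  obtain ⟨c₁t, hc₁t, hT⟩ := hT4
  obtain ⟨cP, hcP, hP⟩ := hP3
  obtain ⟨c₁', hc₁', hwin⟩ := exists_window_print (d := 4) (L := c.L) (by norm_num) hL C₂ hc₁t hcP hB₁'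
  have h16 : 16 * (5 * ((4 : ℕ) : ℝ) * c.L * inp.B₀ * c₁') ≤ 1 := by
    obtain ⟨-, -, -, h, -⟩ := hwin (c₁' / 2) (c₁' / 2) (by linarith) (by linarith) (by linarith)
    have h' : 16 * (B₁' * c₁') ≤ 1 := by rwa [add_halves] at h
    nlinarith [mul_le_mul_of_nonneg_right hBB hc₁'.le]
  refine ⟨c₁', hc₁', h16, fun b' c' hb' hc' hRb hcF α hα hA3 hA2 hAs hAc hb'α hc'α Mc hMc hMcα 𝒬 h𝒬 C335 hC335 hεα hss hgrad hℓ hhol h3 => ?_⟩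
  exact ⟨len, c₁t, c₁', B₁', cP, C₂, B₀β, inp, 5 * ((4 : ℕ) : ℝ) * c.L * inp.B₀, 5 * ((4 : ℕ) : ℝ) * c.L * B₀β, b', c', α, Mc, C335, 𝒬, hlen, hlen1,
    hB₁', hBB, rfl, rfl, by linarith [h16], hwin, hb', hc', hRb, hcF, hα, hA3, hA2, hAs, hAc, hb'α, hc'α, hMc, hMcα, h𝒬, hC335, hεα, hss, hgrad, hℓ,
    hhol, hT, hP, h3⟩

/-- **β = 1: FROM NODE N05's THEOREM 4 AND PROPOSITION 3 TO n16-e's LEAF SLOT OF RECORD `LeafSlot c`** (`2 ≤ c.L`) — n16-e's `N16LeafSlotRS.leafSlot_of_b8LeafRS` re-cut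
the same way: `leafSlotHolder_of_leafTP` at `β := 1` through `N16HolderLeafSlot.leafSlotHolder_one_iff` (`LeafSlotHolder c 1 ↔ LeafSlot c`, `Iff.rfl`).
[cite: Balaban1985RegularSpaces, Thm 4 p.88, Prop. 3 p.87] [folklore] -/
theorem leafSlot_of_leafTP [NeZero N] (c : NE3Carriers N) (hL : 2 ≤ c.L) {C₂ B₁' : ℝ} {inp : B8.B9Inputs} {B₀β : ℝ}
    {len : Site 4 → ℝ} (hlen : ∀ v : Site 4, 0 < len v → 1 ≤ len v) (hlen1 : ∀ μ : Fin 4, len (e μ) = 1) (hB₁' : 0 < B₁')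
    (hBB : 5 * ((4 : ℕ) : ℝ) * c.L * inp.B₀ ≤ B₁')
    (hT4 : letI : CStarAlgebra (Matrix (Fin N) (Fin N) ℂ) := {}
      B8.Thm4Printed B₁' (fun i : {i : ZdIdx 4 c.L // i.Ω 0 = Set.univ} => (zdGF3 (Matrix (Fin N) (Fin N) ℂ) c.L 1 len i.1).toGFData))
    (hP3 : letI : CStarAlgebra (Matrix (Fin N) (Fin N) ℂ) := {}
      B8.Prop3Printed 4 (c.L : ℝ) C₂ inp B₀β
        (fun i : {i : ZdIdx 4 c.L // i.Ω 0 = Set.univ} => (zdGF3 (Matrix (Fin N) (Fin N) ℂ) c.L 1 len i.1).toGFData2)) :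
    ∃ c₁' : ℝ, 0 < c₁' ∧ 16 * (5 * ((4 : ℕ) : ℝ) * c.L * inp.B₀ * c₁') ≤ 1 ∧
      ∀ ⦃b' c' : ℝ⦄, 0 ≤ b' → 0 ≤ c' →
      2 ^ 15 * ((4 : ℝ) + 1) ^ 2 * ((4 : ℝ) + 4) ^ 2 * (c.L : ℝ) ^ 2 * b' ≤ 1 →
      23040 * (4 : ℝ) ^ 4 * (frameC 4 c.L + 4) ^ 3 * (c' + curConst 4 c.L * b' ^ 2) ≤ 1 →
      ∀ ⦃α : ℝ⦄, 0 < α → C0 4 * α ≤ 1 / 3 → 2 * α ≤ c2' 4 c.L → 11 * (4 : ℝ) ^ 2 * α ≤ 1 / 6 → α + 11 * (4 : ℝ) ^ 2 * α ≤ c₁' →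
      b' + 226 * (8 * ((4 : ℝ) + 1) * ((4 : ℝ) + 4)) ^ 2 * b' ^ 2 < α → 4 * ((4 : ℝ) - 1) * (c' + curConst 4 c.L * b' ^ 2) < α →
      ∀ ⦃Mc : ℝ⦄, 0 ≤ Mc → (Mc + 1) * (b' + 226 * (8 * ((4 : ℝ) + 1) * ((4 : ℝ) + 4)) ^ 2 * b' ^ 2) ≤ 1 / 2 →
      ∀ (𝒬 : ℕ → Set (Set (Site 4) × ℕ)), (∀ k, ∀ q ∈ 𝒬 k, q.2 ≤ k ∧ ∃ y : Site 4, ∀ z ∈ q.1, (l1 (z - y) : ℝ) ≤ Mc * (c.L : ℝ) ^ q.2) →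
      ∀ ⦃C335 : ℝ⦄, 2 * (Mc + 1) * (b' + 226 * (8 * ((4 : ℝ) + 1) * ((4 : ℝ) + 4)) ^ 2 * b' ^ 2) + 2 * Mc * (2 * (c' + curConst 4 c.L * b' ^ 2)) +
        4 * Mc * (1 + 2 * Mc) * (b' + 226 * (8 * ((4 : ℝ) + 1) * ((4 : ℝ) + 4)) ^ 2 * b' ^ 2) ^ 2 < C335 →
      c.ε < α → 5 * ((4 : ℕ) : ℝ) * c.L * inp.B₀ * (α + 11 * (4 : ℝ) ^ 2 * α) ≤ c.Λ₁ →
      5 * ((4 : ℕ) : ℝ) * c.L * inp.B₀ * (α + 11 * (4 : ℝ) ^ 2 * α) +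
          2 * (b' + 226 * (8 * ((4 : ℝ) + 1) * ((4 : ℝ) + 4)) ^ 2 * b' ^ 2) * c.Λ₁ ≤ c.Λ₁ →
      5 * ((4 : ℕ) : ℝ) * c.L * inp.B₀ * (α + 11 * (4 : ℝ) ^ 2 * α) + 16 * (b' + 226 * (8 * ((4 : ℝ) + 1) * ((4 : ℝ) + 4)) ^ 2 * b' ^ 2) *
          (5 * ((4 : ℕ) : ℝ) * c.L * inp.B₀ * (α + 11 * (4 : ℝ) ^ 2 * α)) ≤ c.Λ₁ →
      5 * ((4 : ℕ) : ℝ) * c.L * B₀β * (α + 11 * (4 : ℝ) ^ 2 * α) + 8 * (b' + 226 * (8 * ((4 : ℝ) + 1) * ((4 : ℝ) + 4)) ^ 2 * b' ^ 2) *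
          (5 * ((4 : ℕ) : ℝ) * c.L * inp.B₀ * (α + 11 * (4 : ℝ) ^ 2 * α)) ≤ c.Λ₂' →
      LeafH3sup 4 c.L c.Nper c.ε b' c' c.dom → LeafSlot c := by
  obtain ⟨c₁', hc₁', h16, h⟩ := leafSlotHolder_of_leafTP c hL hlen hlen1 hB₁' hBB hT4 hP3
  refine ⟨c₁', hc₁', h16, fun b' c' hb' hc' hRb hcF α hα hA3 hA2 hAs hAc hb'α hc'α Mc hMc hMcα 𝒬 h𝒬 C335 hC335 hεα hss hgrad hℓ hhol h3 => ?_⟩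
  exact (leafSlotHolder_one_iff c).1 (h hb' hc' hRb hcF hα hA3 hA2 hAs hAc hb'α hc'α hMc hMcα 𝒬 h𝒬 hC335 hεα hss hgrad hℓ hhol h3)

/-- **FROM NODE N05's THEOREM 4 AND PROPOSITION 3 AT ITS RESIDUAL EXPONENT TO n16-e's MS LEAF β-SLOT** (`2 ≤ c.L`; any `β`) — n16-e's
`N16HolderMSLeafSlot.leafSlotHolderMS_of_b8LeafRS` with its uninhabited hypothesis `B8LeafRS …` REPLACED by `B8.Thm4Printed B₁′ fam` and `B8.Prop3Printed 4 c.L C₂ inp B₀β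
fam₂` at `fam := fun i : {i : ZdIdx 4 c.L // i.Ω 0 = univ} ↦ zdGF3 (M_N ℂ) c.L β len i.1`; `len ≥ 1` on its support, the LENGTH LETTER `len (j•e_μ) = j`, `0 < B₁′`,
`5·4·c.L·B₀ ≤ B₁′` YIELD `c₁′ > 0` with `16·(5·4·c.L·B₀·c₁′) ≤ 1` such that for all leaf letters, averaging letter, (3.35) schedule on the slot's displayed lines at `c₁′` with
`B := 5·4·c.L·B₀`, `B_h := 5·4·c.L·B₀β` (Hölder threshold `10·`), N07's `LeafH3sup` gives `LeafSlotHolderMS c β`. [cite: Balaban1985RegularSpaces, Thm 4 p.88, Prop. 3 p.87, (1.36) p.82] [folklore] -/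
theorem leafSlotHolderMS_of_leafTP [NeZero N] (c : NE3Carriers N) (hL : 2 ≤ c.L) {β : ℝ} {C₂ B₁' : ℝ} {inp : B8.B9Inputs} {B₀β : ℝ}
    {len : Site 4 → ℝ} (hlen : ∀ v : Site 4, 0 < len v → 1 ≤ len v) (hlenj : ∀ (μ : Fin 4) (j : ℕ), len (j • e μ) = j) (hB₁' : 0 < B₁')
    (hBB : 5 * ((4 : ℕ) : ℝ) * c.L * inp.B₀ ≤ B₁')
    (hT4 : letI : CStarAlgebra (Matrix (Fin N) (Fin N) ℂ) := {}
      B8.Thm4Printed B₁' (fun i : {i : ZdIdx 4 c.L // i.Ω 0 = Set.univ} => (zdGF3 (Matrix (Fin N) (Fin N) ℂ) c.L β len i.1).toGFData))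
    (hP3 : letI : CStarAlgebra (Matrix (Fin N) (Fin N) ℂ) := {}
      B8.Prop3Printed 4 (c.L : ℝ) C₂ inp B₀β
        (fun i : {i : ZdIdx 4 c.L // i.Ω 0 = Set.univ} => (zdGF3 (Matrix (Fin N) (Fin N) ℂ) c.L β len i.1).toGFData2)) :
    ∃ c₁' : ℝ, 0 < c₁' ∧ 16 * (5 * ((4 : ℕ) : ℝ) * c.L * inp.B₀ * c₁') ≤ 1 ∧
      ∀ ⦃b' c' : ℝ⦄, 0 ≤ b' → 0 ≤ c' →
      2 ^ 15 * ((4 : ℝ) + 1) ^ 2 * ((4 : ℝ) + 4) ^ 2 * (c.L : ℝ) ^ 2 * b' ≤ 1 →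
      23040 * (4 : ℝ) ^ 4 * (frameC 4 c.L + 4) ^ 3 * (c' + curConst 4 c.L * b' ^ 2) ≤ 1 →
      ∀ ⦃α : ℝ⦄, 0 < α → C0 4 * α ≤ 1 / 3 → 2 * α ≤ c2' 4 c.L → 11 * (4 : ℝ) ^ 2 * α ≤ 1 / 6 → α + 11 * (4 : ℝ) ^ 2 * α ≤ c₁' →
      b' + 226 * (8 * ((4 : ℝ) + 1) * ((4 : ℝ) + 4)) ^ 2 * b' ^ 2 < α → 4 * ((4 : ℝ) - 1) * (c' + curConst 4 c.L * b' ^ 2) < α →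
      ∀ ⦃Mc : ℝ⦄, 0 ≤ Mc → (Mc + 1) * (b' + 226 * (8 * ((4 : ℝ) + 1) * ((4 : ℝ) + 4)) ^ 2 * b' ^ 2) ≤ 1 / 2 →
      ∀ (𝒬 : ℕ → Set (Set (Site 4) × ℕ)), (∀ k, ∀ q ∈ 𝒬 k, q.2 ≤ k ∧ ∃ y : Site 4, ∀ z ∈ q.1, (l1 (z - y) : ℝ) ≤ Mc * (c.L : ℝ) ^ q.2) →
      ∀ ⦃C335 : ℝ⦄, 2 * (Mc + 1) * (b' + 226 * (8 * ((4 : ℝ) + 1) * ((4 : ℝ) + 4)) ^ 2 * b' ^ 2) + 2 * Mc * (2 * (c' + curConst 4 c.L * b' ^ 2)) +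
        4 * Mc * (1 + 2 * Mc) * (b' + 226 * (8 * ((4 : ℝ) + 1) * ((4 : ℝ) + 4)) ^ 2 * b' ^ 2) ^ 2 < C335 →
      c.ε < α → 5 * ((4 : ℕ) : ℝ) * c.L * inp.B₀ * (α + 11 * (4 : ℝ) ^ 2 * α) ≤ c.Λ₁ →
      5 * ((4 : ℕ) : ℝ) * c.L * inp.B₀ * (α + 11 * (4 : ℝ) ^ 2 * α) +
          2 * (b' + 226 * (8 * ((4 : ℝ) + 1) * ((4 : ℝ) + 4)) ^ 2 * b' ^ 2) * c.Λ₁ ≤ c.Λ₁ →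
      5 * ((4 : ℕ) : ℝ) * c.L * inp.B₀ * (α + 11 * (4 : ℝ) ^ 2 * α) + 16 * (b' + 226 * (8 * ((4 : ℝ) + 1) * ((4 : ℝ) + 4)) ^ 2 * b' ^ 2) *
          (5 * ((4 : ℕ) : ℝ) * c.L * inp.B₀ * (α + 11 * (4 : ℝ) ^ 2 * α)) ≤ c.Λ₁ →
      5 * ((4 : ℕ) : ℝ) * c.L * B₀β * (α + 11 * (4 : ℝ) ^ 2 * α) + 10 * (b' + 226 * (8 * ((4 : ℝ) + 1) * ((4 : ℝ) + 4)) ^ 2 * b' ^ 2) *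
          (5 * ((4 : ℕ) : ℝ) * c.L * inp.B₀ * (α + 11 * (4 : ℝ) ^ 2 * α)) ≤ c.Λ₂' →
      LeafH3sup 4 c.L c.Nper c.ε b' c' c.dom → LeafSlotHolderMS c β := by
  letI : CStarAlgebra (Matrix (Fin N) (Fin N) ℂ) := {}
  -- the two printed thresholds, and the window threshold below them
  obtain ⟨c₁t, hc₁t, hT⟩ := hT4
  obtain ⟨cP, hcP, hP⟩ := hP3
  obtain ⟨c₁', hc₁', hwin⟩ := exists_window_print (d := 4) (L := c.L) (by norm_num) hL C₂ hc₁t hcP hB₁'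
  have h16 : 16 * (5 * ((4 : ℕ) : ℝ) * c.L * inp.B₀ * c₁') ≤ 1 := by
    obtain ⟨-, -, -, h, -⟩ := hwin (c₁' / 2) (c₁' / 2) (by linarith) (by linarith) (by linarith)
    have h' : 16 * (B₁' * c₁') ≤ 1 := by rwa [add_halves] at h
    nlinarith [mul_le_mul_of_nonneg_right hBB hc₁'.le]
  refine ⟨c₁', hc₁', h16, fun b' c' hb' hc' hRb hcF α hα hA3 hA2 hAs hAc hb'α hc'α Mc hMc hMcα 𝒬 h𝒬 C335 hC335 hεα hss hgrad hℓ hhol h3 => ?_⟩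
  exact ⟨len, c₁t, c₁', B₁', cP, C₂, B₀β, inp, 5 * ((4 : ℕ) : ℝ) * c.L * inp.B₀, 5 * ((4 : ℕ) : ℝ) * c.L * B₀β, b', c', α, Mc, C335, 𝒬, hlen, hlenj,
    hB₁', hBB, rfl, rfl, by linarith [h16], hwin, hb', hc', hRb, hcF, hα, hA3, hA2, hAs, hAc, hb'α, hc'α, hMc, hMcα, h𝒬, hC335, hεα, hss, hgrad, hℓ,
    hhol, hT, hP, h3⟩

end Slots

end

end Summit.QuantumFields.YangMills.BalabanUVNodes.N16OfLeafTPHolder
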